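import Mathlib
import Summits.Ventures.PercRepro2.TypedUntouchedMarks
import Summits.Ventures.PercRepro2.SepSplitFrozen

/-!
# Gluing at a general separator, XII: the orbit sums vanish when the glued part of `o` or of `b`
is frozen by the far data (blind cell PercRepro2, mine-2 g49, 2026-08-29;
`conjectures/MINE-2.md` M2-99 addendum 2)

The marks `o` and `b` behave like the roots: night-3's `KBsym_eq_zero_of_o / _b`
(`TypedUntouchedMarks.lean`) say the `S₃`-symmetrised kernel vanishes on state triples whose
three copies share the status `(L_o, H_o)` of `o` (resp. `(L_b, H_b)` of `b`), with no condition
on the other coordinates.  A far-side `o` off the separator has its status read from the far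
datum alone — `frozenO side p = (side 1 && p(1, 0), side 2 && p(2, 0))`
(`gluedS_eq_mkSt_of_offSep_o`, by `connS_right_of_offSep`) — so by the diagonal rewriting
`orbitRootS_eq_typedCount_KBsym` the orbit sum of a data triple with `o` off the separator in all
three far data and one and the same frozen status is ZERO on every root side
(`orbitRootS_eq_zero_of_offSep_o`); likewise for `b` (`frozenB`, `orbitRootS_eq_zero_of_offSep_b`);
the isolated cases `orbitRootS_eq_zero_of_isoFar_o / _b`.  The mark `a₃` is exempt (night-3: the
kernel identity fails on 2,952 of the 131,072 triples with a common `a₃`-status).  Own work;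
standard axioms.
-/

namespace Summit.Ventures.PercRepro2

open UnionCluster

namespace CovForm

namespace RootBridge

open OneTyped TypedA3 Untouched TypedFactor Separated

/-! ## The frozen status of `o` and of `b` -/

section FrozenMarks

open Classical

variable {ι : Type*}

/-- The status `(L_o, H_o)` of a far-side `o` off the separator, read from the far datum. -/
def frozenO (side : Fin 5 → Bool) (p : SideData ι) : Bool × Bool :=
  (side 1 && p.1 1 0, side 2 && p.1 2 0)

/-- The status `(L_b, H_b)` of a far-side `b` off the separator, read from the far datum. -/
def frozenB (side : Fin 5 → Bool) (p : SideData ι) : Bool × Bool :=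
  (side 1 && p.1 1 4, side 2 && p.1 2 4)

/-- With `o` a far mark off the separator, the glued state has the frozen status of `o`. -/
lemma gluedS_eq_mkSt_of_offSep_o (h p : SideData ι) (side : Fin 5 → Bool) (h0 : side 0 = true)
    (hoff : OffSep p 0) :
    gluedS h p side = mkSt (decide (connS h p side 2 1)) (frozenO side p).1
      (decide (connS h p side 1 4)) (decide (connS h p side 1 3)) (frozenO side p).2
      (decide (connS h p side 2 4)) (decide (connS h p side 2 3)) := by
  unfold gluedS mkSt frozenO
  rw [decide_connS_right_of_offSep h p side h0 hoff 1, decide_connS_right_of_offSep h p side h0 hoff 2]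

/-- With `b` a far mark off the separator, the glued state has the frozen status of `b`. -/
lemma gluedS_eq_mkSt_of_offSep_b (h p : SideData ι) (side : Fin 5 → Bool) (h4 : side 4 = true)
    (hoff : OffSep p 4) :
    gluedS h p side = mkSt (decide (connS h p side 2 1)) (decide (connS h p side 1 0))
      (frozenB side p).1 (decide (connS h p side 1 3)) (decide (connS h p side 2 0))
      (frozenB side p).2 (decide (connS h p side 2 3)) := by
  unfold gluedS mkSt frozenB
  rw [decide_connS_right_of_offSep h p side h4 hoff 1, decide_connS_right_of_offSep h p side h4 hoff 2]

/-- An isolated `o` has the all-`false` frozen status. -/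
lemma frozenO_eq_of_isoFar (side : Fin 5 → Bool) (p : SideData ι) (h : IsoFar side p 0) :
    frozenO side p = (false, false) := by
  unfold frozenO
  have e : ∀ l, l ≠ 0 → (side l && p.1 l 0) = false := fun l hl => by
    by_cases hs : side l = true
    · rw [(h.2 l hs hl).2]; simp
    · simp only [Bool.not_eq_true] at hs
      rw [hs]; simp
  rw [e 1 (by decide), e 2 (by decide)]

/-- An isolated `b` has the all-`false` frozen status. -/
lemma frozenB_eq_of_isoFar (side : Fin 5 → Bool) (p : SideData ι) (h : IsoFar side p 4) :
    frozenB side p = (false, false) := by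
  unfold frozenB
  have e : ∀ l, l ≠ 4 → (side l && p.1 l 4) = false := fun l hl => by
    by_cases hs : side l = true
    · rw [(h.2 l hs hl).2]; simp
    · simp only [Bool.not_eq_true] at hs
      rw [hs]; simp
  rw [e 1 (by decide), e 2 (by decide)]

end FrozenMarks

/-! ## The vanishing theorems for `o` and `b` -/

section VanishingMarks

open Classical

variable {V : Type*} {E : Type*} {ι : Type*} [Fintype E] [DecidableEq E] {R : Type*} [Field R]
variable (ends : E → Sym2 V) (mk : Fin 5 → V) (σ : ι → V)

/-- **The orbit sum vanishes when `o` is off the separator in the three far data with one and the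
same frozen status**, on every root side (types in `{1, 2}`), realised or not. -/
theorem orbitRootS_eq_zero_of_offSep_o (side : Fin 5 → Bool) (h0 : side 0 = true) (VH : Set V)
    (B : Finset E) (z : Config E) (τ : E → ℕ) (hτ : ∀ e ∈ B, τ e = 1 ∨ τ e = 2) (p : Pat3S ι)
    (hoff : OffSep p.1 0 ∧ OffSep p.2.1 0 ∧ OffSep p.2.2 0)
    (hsame : frozenO side p.1 = frozenO side p.2.2 ∧ frozenO side p.2.1 = frozenO side p.2.2) :
    orbitRootS ends mk σ side VH B z τ p = (0 : R) := by
  rw [orbitRootS_eq_typedCount_KBsym ends mk σ side VH B z τ hτ p, ← typedCount_zero_kernel B z τ]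
  refine typedCount_congr' _ _ _ _ _ fun x y w => ?_
  unfold gst
  rw [gluedS_eq_mkSt_of_offSep_o _ _ side h0 hoff.1, gluedS_eq_mkSt_of_offSep_o _ _ side h0 hoff.2.1,
    gluedS_eq_mkSt_of_offSep_o _ _ side h0 hoff.2.2, hsame.1, hsame.2, KBsym_eq_zero_of_o]
  simp

/-- **The orbit sum vanishes when `b` is off the separator in the three far data with one and the
same frozen status**, on every root side (types in `{1, 2}`), realised or not. -/
theorem orbitRootS_eq_zero_of_offSep_b (side : Fin 5 → Bool) (h4 : side 4 = true) (VH : Set V)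
    (B : Finset E) (z : Config E) (τ : E → ℕ) (hτ : ∀ e ∈ B, τ e = 1 ∨ τ e = 2) (p : Pat3S ι)
    (hoff : OffSep p.1 4 ∧ OffSep p.2.1 4 ∧ OffSep p.2.2 4)
    (hsame : frozenB side p.1 = frozenB side p.2.2 ∧ frozenB side p.2.1 = frozenB side p.2.2) :
    orbitRootS ends mk σ side VH B z τ p = (0 : R) := by
  rw [orbitRootS_eq_typedCount_KBsym ends mk σ side VH B z τ hτ p, ← typedCount_zero_kernel B z τ]
  refine typedCount_congr' _ _ _ _ _ fun x y w => ?_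
  unfold gst
  rw [gluedS_eq_mkSt_of_offSep_b _ _ side h4 hoff.1, gluedS_eq_mkSt_of_offSep_b _ _ side h4 hoff.2.1,
    gluedS_eq_mkSt_of_offSep_b _ _ side h4 hoff.2.2, hsame.1, hsame.2, KBsym_eq_zero_of_b]
  simp

/-- **`o` isolated in the three far data ⟹ the orbit sum is zero.** -/
theorem orbitRootS_eq_zero_of_isoFar_o (side : Fin 5 → Bool) (h0 : side 0 = true) (VH : Set V)
    (B : Finset E) (z : Config E) (τ : E → ℕ) (hτ : ∀ e ∈ B, τ e = 1 ∨ τ e = 2) (p : Pat3S ι)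
    (hiso : IsoFar side p.1 0 ∧ IsoFar side p.2.1 0 ∧ IsoFar side p.2.2 0) :
    orbitRootS ends mk σ side VH B z τ p = (0 : R) :=
  orbitRootS_eq_zero_of_offSep_o ends mk σ side h0 VH B z τ hτ p
    ⟨hiso.1.1, hiso.2.1.1, hiso.2.2.1⟩
    ⟨by rw [frozenO_eq_of_isoFar side p.1 hiso.1, frozenO_eq_of_isoFar side p.2.2 hiso.2.2],
      by rw [frozenO_eq_of_isoFar side p.2.1 hiso.2.1, frozenO_eq_of_isoFar side p.2.2 hiso.2.2]⟩

/-- **`b` isolated in the three far data ⟹ the orbit sum is zero.** -/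
theorem orbitRootS_eq_zero_of_isoFar_b (side : Fin 5 → Bool) (h4 : side 4 = true) (VH : Set V)
    (B : Finset E) (z : Config E) (τ : E → ℕ) (hτ : ∀ e ∈ B, τ e = 1 ∨ τ e = 2) (p : Pat3S ι)
    (hiso : IsoFar side p.1 4 ∧ IsoFar side p.2.1 4 ∧ IsoFar side p.2.2 4) :
    orbitRootS ends mk σ side VH B z τ p = (0 : R) :=
  orbitRootS_eq_zero_of_offSep_b ends mk σ side h4 VH B z τ hτ p
    ⟨hiso.1.1, hiso.2.1.1, hiso.2.2.1⟩
    ⟨by rw [frozenB_eq_of_isoFar side p.1 hiso.1, frozenB_eq_of_isoFar side p.2.2 hiso.2.2],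
      by rw [frozenB_eq_of_isoFar side p.2.1 hiso.2.1, frozenB_eq_of_isoFar side p.2.2 hiso.2.2]⟩

end VanishingMarks

end RootBridge

end CovForm

end Summit.Ventures.PercRepro2
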